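import Mathlib
import Literature.Analysis.FluidPDE.Tao2016AveragedNS.ShiftSetCascadeFlows
import Literature.Analysis.FluidPDE.Tao2016AveragedNS.ShiftSetCascadeFlux
import Summits.NavierStokesRegularity.NavierStokesRegularity.Theorems.TaoLadderRungTwoFlatCertificateGlueBranchMeshOn
import Summits.NavierStokesRegularity.NavierStokesRegularity.Theorems.TaoLadderRungTwoFlatCertificateGlueCheckerBranchOn
import HarnessLib

/-!
# Certificate glue on a shift set `𝕊`, XXIX-b: THE TRAPPING CLAUSE FROM CHECKED BRANCH CHAINS — a finite family of transit branches, each a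
  chain of step records with box records, all Boolean tests passing, the clock reached, identity start frames, and a cover of the fattened core
  by the start boxes ⇒ the clause `htrap` of glue IV verbatim (glue XXII `htrap_of_branchMeshes` ∘ glue XXIX)
  (helper for items stmt-NavierStokesRegularity-22987 `FlatGapCertificatesV2` (crux K_A♭ of route TaoLadderRungTwoFlat) and stmt-24295 K_A₂(64);
  cell harvest/h2-tao-ladder, p1 g15; CHECKER-SPEC-v3 §3 (v))

The only non-Boolean inputs left: `shifts.Nodup`, `IsNearestNeighbourSet`, positivity of the weight function `ωq`, and the COVER of the fattened
core by the weighted start boxes `|pxcoord S₀ − x_b(0)| ≤ r_b(0)` (an interval-union statement about the explicit core, instance-specific).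

HONEST FRAMING: Tao-type MODEL lattices (Tao 2016 §4/§6 vocabulary, shift-set parametrised); soundness of a checker — NO certificate
instance exists in the tree, nothing is certified here, no stub is closed, nothing here is a statement about the Navier–Stokes equations.
-/

-- the sub-problem namespace repeats the summit name by design (D-0017)
set_option linter.dupNamespace false

namespace Summit.NavierStokesRegularity.NavierStokesRegularity.Theorems

open Set Finset Literature.Analysis.FluidPDE Literature.Analysis.FluidPDE.TaoCascade
open Summit.NavierStokesRegularity.NavierStokesRegularity.Theorems.TaylorModelCert
open Summit.NavierStokesRegularity.NavierStokesRegularity.Theorems.TaylorModelReadout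

namespace CertificateGlueOn

variable {m : ℕ} {Kb Ka : ℤ} {ι : Type*} {Core : (Fin m → ℤ → ℝ) → Prop} {w : ℤ → ℝ} {r : ℝ}

/-- **THE TRAPPING CLAUSE `htrap` FROM CHECKED TRANSIT BRANCH CHAINS.** Per branch `b`: records `rec b`, box records `box b`, `N b` steps with
`checkStepBox` and `checkTransit` passing, the clock `c ≤ Σ_{j<N b} h`, the start frame the identity with `0 ≤ E₀`; globally `checkGlobal`; and
the fattened core covered by the weighted start boxes ⇒ `htrap` (open `M`-box `M k = Mq k`, clock `c`, edge bounds `Eb`, `Et`).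
[cite: Tao2016AveragedNS, §6.3–6.4 Props. 6.4–6.5 (statement shape of a renormalisation certificate); cell certificate format, branch checker] -/
theorem htrap_of_chainChecks (hKb : 0 ≤ Kb) (hKa : 1 ≤ Ka) {shifts : List (ℤ × ℤ × ℤ)} (hnd : shifts.Nodup)
    (h𝕊 : IsNearestNeighbourSet shifts.toFinset) {q : ℚ}
    {αq : Fin m → Fin m → Fin m → ℤ × ℤ × ℤ → ℚ} {ωq : Fin m → ℤ → ℚ} (hω : ∀ i k, 0 < ωq i k)
    {prec p kexp nexp : ℕ} {Sp Sm : IntervalD} {bD : Dyad} {Eb Et c : ℚ} {Mq : ℤ → ℚ}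
    {rec : ι → ℕ → StepRec} {box : ι → ℕ → BoxRec} {N : ι → ℕ}
    (hg : checkGlobal m Kb Ka prec shifts αq ωq q Sp Sm bD = true)
    (hs : ∀ b j, j < N b → checkStepBox m Kb Ka prec p kexp nexp shifts αq ωq Sp Sm bD Eb Et (rec b) (box b) j = true)
    (htr : ∀ b j, j < N b → checkTransit m Kb Ka ωq Mq (box b j).lo (box b j).hi = true)
    (hc : ∀ b, c ≤ sumH (rec b) (N b))
    (hid : ∀ b, checkIdFrame (m * winLen Kb Ka) (rec b 0).C = true) (hE : ∀ b, 0 ≤ (rec b 0).E₀)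
    (hcover : ∀ (z S₀ : Fin m → ℤ → ℝ), Core z → (∀ i k, -Kb ≤ k → k ≤ Ka → w k * |S₀ i k - z i k| ≤ r) →
      ∃ b, ∀ d, |pxcoord Kb Ka (fun i k => (ωq i k : ℝ)) S₀ d - dvec (n := m * winLen Kb Ka) (rec b 0).x d| ≤
        dvec (n := m * winLen Kb Ka) (rec b 0).r d) :
    ∀ (s : ℝ) (z : Fin m → ℤ → ℝ) (S : Fin m → ℤ → ℝ → ℝ), Core z → 0 < s → s ≤ (c : ℝ) →
      (∀ i k, -Kb ≤ k → k ≤ Ka → w k * |S i k 0 - z i k| ≤ r) →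
      (∀ i k, -Kb ≤ k → k ≤ Ka → ∀ u ∈ Icc 0 s,
        HasDerivWithinAt (S i k) (quadTermOn shifts.toFinset (q : ℝ) (fun i₁ i₂ i μ => (αq i₁ i₂ i μ : ℝ)) S i k u) (Icc 0 s) u) →
      (∀ i, ContinuousOn (S i (-Kb - 1)) (Icc 0 s)) → (∀ i, ContinuousOn (S i (Ka + 1)) (Icc 0 s)) →
      (∀ i, ∀ u ∈ Icc 0 s, |S i (-Kb - 1) u| ≤ (Eb : ℝ)) →
      (∀ i, ∀ u ∈ Icc 0 s, |S i (Ka + 1) u| ≤ (Et : ℝ)) →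
      (∀ i k, -Kb ≤ k → k ≤ Ka → ∀ u ∈ Icc 0 s, |S i k u| ≤ (Mq k : ℝ)) →
        ∀ i k, -Kb ≤ k → k ≤ Ka → ∀ u ∈ Icc 0 s, |S i k u| < (Mq k : ℝ) := by
  have hbr := fun b => transitBranch_of_checks hKb hKa hnd h𝕊 hω hg (hs b) (htr b)
  exact htrap_of_branchMeshes
    (Box := fun b S₀ => ∀ d, |pxcoord Kb Ka (fun i k => (ωq i k : ℝ)) S₀ d - dvec (n := m * winLen Kb Ka) (rec b 0).x d| ≤
      dvec (n := m * winLen Kb Ka) (rec b 0).r d)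
    (t := fun b => tOf (rec b)) (Node := fun b => nodeOf Kb Ka ωq (rec b))
    (Hull := fun b => hullOfB Kb Ka shifts q αq ωq prec p Sp Sm bD (rec b))
    hcover (fun b => (hbr b).1) (fun b => (hbr b).2.1) (fun b => le_tOf_of_le_sumH (hc b))
    (fun b y hy => node0_of_box (hid b) (hE b) hy) (fun b => (hbr b).2.2.1) (fun b => (hbr b).2.2.2)

end CertificateGlueOn

end Summit.NavierStokesRegularity.NavierStokesRegularity.Theorems
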